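import Summits.AtomisticToContinuum.BoseEinsteinCondensation.Theorems.InfraredMinimumUncertainty.Negative.DensityWaveCommutator

/-!
# Negative lemmas for crux `InfraredMinimumUncertainty` (stmt-AtomisticToContinuum-11784) — XI:
# insertion pairings against the commutator amplitude of the free density wave

Supports (does not close) stmt-AtomisticToContinuum-11784.  Importable form of §H (part 3 of 6) of the
cdisprove seat's standing file `Cruxes/InfraredMinimumUncertainty/Disproof.lean` (generation 2).

* `integral_cell_conj_cellWave_mul_betaFactor_mul` (`∫_cell ē β φ = 1`),
  `integral_cell_cellWave_mul_betaFactor_mul` (`∫_cell e β φ = −ε²/(1+2ε²)`);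
* `integral_insertion_mul_commutatorAmp_waveFun`: `∫ (∑ₗ q(x_l)) W Ψ̄ = ‖k‖² N ∫_cell q φ β` for every
  continuous one-body multiplier `q` (off-diagonal slot pairs vanish);
* **`integral_commutatorAmp_mul_conj_waveFun`: `∫ W Ψ̄ = 0`**;
  `integral_conj_densityMode_mul_commutatorAmp_waveFun`: `∫ Z̄ W Ψ̄ = N‖k‖²` (the f-sum rule, as it must);
  `integral_densityMode_mul_commutatorAmp_waveFun`: `∫ Z W Ψ̄ = −N‖k‖² ε²/(1+2ε²)` (`= −‖k‖² E[Z_{2e₀}]`,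
  exactly the Stein-identity prediction for `φ(z) = z̄`).
-/

noncomputable section

open MeasureTheory Filter Set
open scoped ENNReal NNReal Topology ComplexConjugate BigOperators

namespace Summit.AtomisticToContinuum.BoseEinsteinCondensation.Theorems.InfraredMinimumUncertainty.Negative

open Literature.MathematicalPhysics.QuantumManyBody.BoseGas
open Summit.AtomisticToContinuum.BoseEinsteinCondensation.Theses.BECConjugateDomination
open Summit.AtomisticToContinuum.BoseEinsteinCondensation.Cruxes.InfraredMinimumUncertainty.FisherGaussianDensityMode
open Summit.AtomisticToContinuum.BoseEinsteinCondensation.Theorems.GaussianDominationCan.Negative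
  (prodFun contDiff_prodFun fderiv_prodFun integral_cellN_prod)
open Summit.AtomisticToContinuum.BoseEinsteinCondensation.Theorems.StaticResponseBound.Negative
  (arg re_cellWave integral_norm_sq_eq_one phiMode argCLM argCLM_apply integral_cell_trig_combo
    phiMode_sq integral_cell_phiMode_sq arg_intSMul isRepulsiveFiniteRange_zero)
open Summit.AtomisticToContinuum.BoseEinsteinCondensation.Theorems.CorrectorClosure.Negative
  (e0 e0_ne_zero sideLength_succ_pos)

/-! ### Insertion pairings against the commutator amplitude of the density wave -/

section Pairings

variable {L : ℝ} {ε : ℝ} {n : ℕ}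


/-- `∫_cell e⁴ = 0` (the plane wave `e_{4e₀}`). [folklore] -/
theorem integral_cell_cellWave_pow_four (hL : 0 < L) {k : Fin 3 → ℤ} (hk : k ≠ 0) :
    ∫ x in cell L, cellWave L k x * cellWave L k x * cellWave L k x * cellWave L k x = 0 := by
  simp_rw [← cellWave_add_index]
  refine integral_cell_cellWave_eq_zero hL ?_
  intro h
  apply hk
  funext j
  have := congrFun h j
  simp only [Pi.add_apply, Pi.zero_apply] at this
  simp only [Pi.zero_apply]
  omega

/-- `∫_cell conj(e)·conj(e) = 0`. [folklore] -/
theorem integral_cell_conj_cellWave_sq (hL : 0 < L) {k : Fin 3 → ℤ} (hk : k ≠ 0) :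
    ∫ x in cell L, conj (cellWave L k x) * conj (cellWave L k x) = 0 := by
  simp_rw [← map_mul]
  rw [integral_conj, integral_cell_cellWave_sq hL hk, map_zero]

/-- `∫_cell ē β φ_ℂ = 1` (the diagonal of the f-sum pairing). [folklore] -/
theorem integral_cell_conj_cellWave_mul_betaFactor_mul (hL : 0 < L) (ε : ℝ) :
    ∫ x in cell L, conj (cellWave L e0 x) * (betaFactor L ε x * waveFactorC L ε x) = 1 := by
  have h1 : ∀ x, conj (cellWave L e0 x) * (betaFactor L ε x * waveFactorC L ε x) =
      ((cnorm L ε ^ 2 : ℝ) : ℂ) * ((1 + 2 * ε ^ 2) + 4 * ε * cellWave L e0 x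
        + 3 * ε ^ 2 * (cellWave L e0 x * cellWave L e0 x)
        - ε ^ 2 * (conj (cellWave L e0 x) * conj (cellWave L e0 x))) := by
    intro x
    rw [betaFactor_mul_waveFactorC]
    have h := cellWave_mul_conj L e0 x
    linear_combination ((cnorm L ε ^ 2 : ℝ) : ℂ) * ((1 + 2 * (ε : ℂ) ^ 2)
      + 4 * (ε : ℂ) * cellWave L e0 x + 3 * (ε : ℂ) ^ 2 * (cellWave L e0 x * cellWave L e0 x)) * h
  simp_rw [h1]
  rw [integral_const_mul]
  have i0 : Integrable (fun _ : Space => ((1 + 2 * ε ^ 2 : ℝ) : ℂ)) (volume.restrict (cell L)) := by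
    haveI := Summit.AtomisticToContinuum.BoseEinsteinCondensation.Theorems.StaticResponseBound.Negative.isFiniteMeasure_restrict_cell L
    exact integrable_const _
  have ie : Integrable (cellWave L e0) (volume.restrict (cell L)) :=
    integrableOn_cell (continuous_cellWave L e0)
  have ie2 : Integrable (fun x => cellWave L e0 x * cellWave L e0 x) (volume.restrict (cell L)) :=
    integrableOn_cell ((continuous_cellWave L e0).mul (continuous_cellWave L e0))
  have iec2 : Integrable (fun x => conj (cellWave L e0 x) * conj (cellWave L e0 x))
      (volume.restrict (cell L)) :=
    integrableOn_cell ((Complex.continuous_conj.comp (continuous_cellWave L e0)).mul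
      (Complex.continuous_conj.comp (continuous_cellWave L e0)))
  have i1 : Integrable (fun x => 4 * (ε : ℂ) * cellWave L e0 x) (volume.restrict (cell L)) :=
    ie.const_mul _
  have i2 : Integrable (fun x => 3 * (ε : ℂ) ^ 2 * (cellWave L e0 x * cellWave L e0 x))
      (volume.restrict (cell L)) := ie2.const_mul _
  have i3 : Integrable (fun x => (ε : ℂ) ^ 2 * (conj (cellWave L e0 x) * conj (cellWave L e0 x)))
      (volume.restrict (cell L)) := iec2.const_mul _
  push_cast at i0
  have i01 : Integrable (fun x => 1 + 2 * (ε : ℂ) ^ 2 + 4 * (ε : ℂ) * cellWave L e0 x)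
      (volume.restrict (cell L)) := i0.add i1
  have i012 : Integrable (fun x => 1 + 2 * (ε : ℂ) ^ 2 + 4 * (ε : ℂ) * cellWave L e0 x
      + 3 * (ε : ℂ) ^ 2 * (cellWave L e0 x * cellWave L e0 x)) (volume.restrict (cell L)) := i01.add i2
  rw [integral_sub i012 i3, integral_add i01 i2, integral_add i0 i1,
    integral_const_mul, integral_const_mul, integral_const_mul,
    integral_cell_cellWave_eq_zero hL e0_ne_zero, integral_cell_cellWave_sq hL e0_ne_zero,
    integral_cell_conj_cellWave_sq hL e0_ne_zero, setIntegral_const]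
  rw [measureReal_def, volume_cell, ← ENNReal.ofReal_pow hL.le, ENNReal.toReal_ofReal (by positivity),
    Complex.real_smul]
  have hc := congrArg (fun r : ℝ => (r : ℂ)) (cnorm_sq_mul hL ε)
  push_cast at hc ⊢
  linear_combination hc

/-- `∫_cell e β φ_ℂ = −ε²/(1 + 2ε²)` (the diagonal of the `Z`-pairing: `−E[e^{2iθ}]` per particle). [folklore] -/
theorem integral_cell_cellWave_mul_betaFactor_mul (hL : 0 < L) (ε : ℝ) :
    ∫ x in cell L, cellWave L e0 x * (betaFactor L ε x * waveFactorC L ε x) =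
      ((-(ε ^ 2 / (1 + 2 * ε ^ 2)) : ℝ) : ℂ) := by
  have h1 : ∀ x, cellWave L e0 x * (betaFactor L ε x * waveFactorC L ε x) =
      ((cnorm L ε ^ 2 : ℝ) : ℂ) * ((1 + 2 * ε ^ 2) * (cellWave L e0 x * cellWave L e0 x)
        + 4 * ε * (cellWave L e0 x * cellWave L e0 x * cellWave L e0 x)
        + 3 * ε ^ 2 * (cellWave L e0 x * cellWave L e0 x * cellWave L e0 x * cellWave L e0 x)
        - ε ^ 2) := by
    intro x
    rw [betaFactor_mul_waveFactorC]
    have h := cellWave_mul_conj L e0 x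
    linear_combination ((cnorm L ε ^ 2 : ℝ) : ℂ) * (-(ε : ℂ) ^ 2) * h
  simp_rw [h1]
  rw [integral_const_mul]
  have ie2 : Integrable (fun x => cellWave L e0 x * cellWave L e0 x) (volume.restrict (cell L)) :=
    integrableOn_cell ((continuous_cellWave L e0).mul (continuous_cellWave L e0))
  have ie3 : Integrable (fun x => cellWave L e0 x * cellWave L e0 x * cellWave L e0 x)
      (volume.restrict (cell L)) :=
    integrableOn_cell (((continuous_cellWave L e0).mul (continuous_cellWave L e0)).mul
      (continuous_cellWave L e0))
  have ie4 : Integrable (fun x => cellWave L e0 x * cellWave L e0 x * cellWave L e0 x * cellWave L e0 x)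
      (volume.restrict (cell L)) :=
    integrableOn_cell ((((continuous_cellWave L e0).mul (continuous_cellWave L e0)).mul
      (continuous_cellWave L e0)).mul (continuous_cellWave L e0))
  have ic : Integrable (fun _ : Space => (ε : ℂ) ^ 2) (volume.restrict (cell L)) := by
    haveI := Summit.AtomisticToContinuum.BoseEinsteinCondensation.Theorems.StaticResponseBound.Negative.isFiniteMeasure_restrict_cell L
    exact integrable_const _
  have i1 : Integrable (fun x => (1 + 2 * (ε : ℂ) ^ 2) * (cellWave L e0 x * cellWave L e0 x))
      (volume.restrict (cell L)) := ie2.const_mul _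
  have i2 : Integrable (fun x => 4 * (ε : ℂ) * (cellWave L e0 x * cellWave L e0 x * cellWave L e0 x))
      (volume.restrict (cell L)) := ie3.const_mul _
  have i3 : Integrable (fun x => 3 * (ε : ℂ) ^ 2 *
      (cellWave L e0 x * cellWave L e0 x * cellWave L e0 x * cellWave L e0 x))
      (volume.restrict (cell L)) := ie4.const_mul _
  have i12 : Integrable (fun x => (1 + 2 * (ε : ℂ) ^ 2) * (cellWave L e0 x * cellWave L e0 x)
      + 4 * (ε : ℂ) * (cellWave L e0 x * cellWave L e0 x * cellWave L e0 x))
      (volume.restrict (cell L)) := i1.add i2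
  have i123 : Integrable (fun x => (1 + 2 * (ε : ℂ) ^ 2) * (cellWave L e0 x * cellWave L e0 x)
      + 4 * (ε : ℂ) * (cellWave L e0 x * cellWave L e0 x * cellWave L e0 x)
      + 3 * (ε : ℂ) ^ 2 * (cellWave L e0 x * cellWave L e0 x * cellWave L e0 x * cellWave L e0 x))
      (volume.restrict (cell L)) := i12.add i3
  rw [integral_sub i123 ic, integral_add i12 i3, integral_add i1 i2,
    integral_const_mul, integral_const_mul, integral_const_mul,
    integral_cell_cellWave_sq hL e0_ne_zero, integral_cell_cellWave_cube hL e0_ne_zero,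
    integral_cell_cellWave_pow_four hL e0_ne_zero, setIntegral_const]
  rw [measureReal_def, volume_cell, ← ENNReal.ofReal_pow hL.le, ENNReal.toReal_ofReal (by positivity),
    Complex.real_smul]
  have hc := congrArg (fun r : ℝ => (r : ℂ)) (cnorm_sq_mul_cube hL ε)
  push_cast at hc ⊢
  rw [div_eq_mul_inv, ← hc]
  ring

/-- **Insertion pairings against the commutator amplitude of the density wave**: for a
continuous one-body multiplier `q`,
`∫ (∑ₗ q(x_l)) W Ψ̄ = ‖k‖² N ∫_cell q φ_ℂ β` (off-diagonal slot pairs vanish by `∫_cell β φ_ℂ = 0`). [folklore] -/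
theorem integral_insertion_mul_commutatorAmp_waveFun (hL : 0 < L) (ε : ℝ) {q : Space → ℂ}
    (hq : Continuous q) :
    ∫ X in cellN (n + 1) L, (∑ l, q (X l)) * commutatorAmp (n + 1) L (waveFun n L ε) e0 X *
        conj (waveFun n L ε X) =
      (((2 * Real.pi / L) ^ 2 : ℝ) : ℂ) * ((n : ℂ) + 1) *
        ∫ x in cell L, (q x * waveFactorC L ε x) * betaFactor L ε x := by
  have hf1 : ∫ x in cell L, waveFactorC L ε x * waveFactorC L ε x = 1 :=
    integral_cell_waveFactorC_mul_self hL ε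
  have hβf : ∫ x in cell L, betaFactor L ε x * waveFactorC L ε x = 0 :=
    integral_cell_betaFactor_mul_waveFactorC hL ε
  have hq' : ∀ (X : Config (n + 1)) (l : Fin (n + 1)), q (X l) * waveFun n L ε X =
      slotFun (waveFactorC L ε) (fun x => q x * waveFactorC L ε x) l X := fun X l => by
    rw [waveFun_eq_slotFun L ε l X]
    unfold slotFun
    ring
  have hpt : ∀ X : Config (n + 1),
      (∑ l, q (X l)) * commutatorAmp (n + 1) L (waveFun n L ε) e0 X * conj (waveFun n L ε X) =
      (((2 * Real.pi / L) ^ 2 : ℝ) : ℂ) * ∑ l, ∑ j,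
        slotFun (waveFactorC L ε) (fun x => q x * waveFactorC L ε x) l X *
          slotFun (waveFactorC L ε) (betaFactor L ε) j X := by
    intro X
    rw [commutatorAmp_waveFun, conj_waveFun]
    have h1 : (∑ l, q (X l)) * ((((2 * Real.pi / L) ^ 2 : ℝ) : ℂ) *
        ∑ j, slotFun (waveFactorC L ε) (betaFactor L ε) j X) * waveFun n L ε X =
        (((2 * Real.pi / L) ^ 2 : ℝ) : ℂ) * (((∑ l, q (X l)) * waveFun n L ε X) *
          ∑ j, slotFun (waveFactorC L ε) (betaFactor L ε) j X) := by ring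
    rw [h1, Finset.sum_mul, Finset.sum_congr rfl fun l _ => hq' X l, Finset.sum_mul_sum]
  simp_rw [hpt]
  rw [integral_const_mul]
  have hint : ∀ l j : Fin (n + 1), Integrable (fun X : Config (n + 1) =>
      slotFun (waveFactorC L ε) (fun x => q x * waveFactorC L ε x) l X *
        slotFun (waveFactorC L ε) (betaFactor L ε) j X) (volume.restrict (cellN (n + 1) L)) :=
    fun l j => integrableOn_cellN ((continuous_slotFun (continuous_waveFactorC L ε)
      (hq.mul (continuous_waveFactorC L ε)) l).mul (continuous_slotFun (continuous_waveFactorC L ε)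
        (continuous_betaFactor L ε) j)) L
  rw [integral_finsetSum _ fun l _ => integrable_finsetSum _ fun j _ => hint l j]
  rw [Finset.sum_congr rfl fun l _ => integral_finsetSum _ fun j _ => hint l j]
  simp_rw [integral_slotFun_mul_slotFun hf1]
  simp only [hβf, mul_zero, Finset.sum_ite_eq, Finset.mem_univ, if_true]
  rw [Finset.sum_const, Finset.card_univ, Fintype.card_fin, nsmul_eq_mul]
  push_cast
  ring

/-- **`⟨Ψ, [−Δ, Z]Ψ⟩ = 0` on the density wave, slot by slot**: `∫ W Ψ̄ = 0`. [folklore] -/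
theorem integral_commutatorAmp_mul_conj_waveFun (hL : 0 < L) (ε : ℝ) :
    ∫ X in cellN (n + 1) L, commutatorAmp (n + 1) L (waveFun n L ε) e0 X * conj (waveFun n L ε X) = 0 := by
  have hf1 : ∫ x in cell L, waveFactorC L ε x * waveFactorC L ε x = 1 :=
    integral_cell_waveFactorC_mul_self hL ε
  have hβf : ∫ x in cell L, betaFactor L ε x * waveFactorC L ε x = 0 :=
    integral_cell_betaFactor_mul_waveFactorC hL ε
  have hpt : ∀ X : Config (n + 1),
      commutatorAmp (n + 1) L (waveFun n L ε) e0 X * conj (waveFun n L ε X) =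
      (((2 * Real.pi / L) ^ 2 : ℝ) : ℂ) * ∑ j,
        slotFun (waveFactorC L ε) (betaFactor L ε) j X *
          slotFun (waveFactorC L ε) (waveFactorC L ε) j X := by
    intro X
    rw [commutatorAmp_waveFun, conj_waveFun, mul_assoc, Finset.sum_mul]
    congr 1
    exact Finset.sum_congr rfl fun j _ => by rw [← waveFun_eq_slotFun L ε j X]
  simp_rw [hpt]
  rw [integral_const_mul]
  have hint : ∀ j : Fin (n + 1), Integrable (fun X : Config (n + 1) =>
      slotFun (waveFactorC L ε) (betaFactor L ε) j X *
        slotFun (waveFactorC L ε) (waveFactorC L ε) j X) (volume.restrict (cellN (n + 1) L)) :=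
    fun j => integrableOn_cellN ((continuous_slotFun (continuous_waveFactorC L ε)
      (continuous_betaFactor L ε) j).mul (continuous_slotFun (continuous_waveFactorC L ε)
        (continuous_waveFactorC L ε) j)) L
  rw [integral_finsetSum _ fun j _ => hint j]
  simp [integral_slotFun_mul_slotFun hf1, hβf]

/-- **The f-sum pairing on the density wave** (consistency check of `commutatorAmp_waveFun` with
the general f-sum rule): `∫ Z̄ W Ψ̄ = N‖k‖²`. [folklore] -/
theorem integral_conj_densityMode_mul_commutatorAmp_waveFun (hL : 0 < L) (ε : ℝ) :
    ∫ X in cellN (n + 1) L, conj (densityMode (n + 1) L e0 X) *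
        commutatorAmp (n + 1) L (waveFun n L ε) e0 X * conj (waveFun n L ε X) =
      (((2 * Real.pi / L) ^ 2 : ℝ) : ℂ) * ((n : ℂ) + 1) := by
  unfold densityMode
  simp_rw [map_sum]
  rw [integral_insertion_mul_commutatorAmp_waveFun hL ε (q := fun x => conj (cellWave L e0 x))
    (Complex.continuous_conj.comp (continuous_cellWave L e0))]
  have : ∫ x in cell L, conj (cellWave L e0 x) * waveFactorC L ε x * betaFactor L ε x = 1 := by
    have hh : ∀ x, conj (cellWave L e0 x) * waveFactorC L ε x * betaFactor L ε x =
        conj (cellWave L e0 x) * (betaFactor L ε x * waveFactorC L ε x) := fun x => by ring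
    simp_rw [hh]
    exact integral_cell_conj_cellWave_mul_betaFactor_mul hL ε
  rw [this, mul_one]

/-- **The `Z`-pairing on the density wave**: `∫ Z W Ψ̄ = −N‖k‖² ε²/(1+2ε²)` (`= −‖k‖² E[Z_{2e₀}]`, as the
Stein form predicts). [folklore] -/
theorem integral_densityMode_mul_commutatorAmp_waveFun (hL : 0 < L) (ε : ℝ) :
    ∫ X in cellN (n + 1) L, densityMode (n + 1) L e0 X *
        commutatorAmp (n + 1) L (waveFun n L ε) e0 X * conj (waveFun n L ε X) =
      (((2 * Real.pi / L) ^ 2 : ℝ) : ℂ) * ((n : ℂ) + 1) * ((-(ε ^ 2 / (1 + 2 * ε ^ 2)) : ℝ) : ℂ) := by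
  unfold densityMode
  rw [integral_insertion_mul_commutatorAmp_waveFun hL ε (continuous_cellWave L e0)]
  have : ∫ x in cell L, cellWave L e0 x * waveFactorC L ε x * betaFactor L ε x =
      ((-(ε ^ 2 / (1 + 2 * ε ^ 2)) : ℝ) : ℂ) := by
    have hh : ∀ x, cellWave L e0 x * waveFactorC L ε x * betaFactor L ε x =
        cellWave L e0 x * (betaFactor L ε x * waveFactorC L ε x) := fun x => by ring
    simp_rw [hh]
    exact integral_cell_cellWave_mul_betaFactor_mul hL ε
  rw [this]

end Pairings

end Summit.AtomisticToContinuum.BoseEinsteinCondensation.Theorems.InfraredMinimumUncertainty.Negative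

end
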